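/-
Copyright: statement-level skeleton of a published paper (lit-balaban cell, Phase-2 proof seat p26 gen 40). No claims beyond
what the kernel checks below.
-/
import Mathlib
import Literature.MathematicalPhysics.QuantumFieldTheory.Balaban1983to89.B3Eq37Pictures
import Literature.MathematicalPhysics.QuantumFieldTheory.Balaban1983to89.B3SmoothLocalization420
import Literature.MathematicalPhysics.QuantumFieldTheory.Balaban1983to89.B3Eq14AuxFunction

/-!
# B3 — T. Bałaban, *(Higgs)₂,₃ quantum fields in a finite volume. III. Renormalization*, CMP **88** (1983) 411–445
[Balaban1983Higgs3] — p. 420 [PDF 10]: the LOCALIZED EXPRESSION **E(G, {□(v)}_{v∈G}, Φ_ext, A_ext)** of a graph and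
**E(G_ren, …) = Σ_{G∈G_ren} E(G, …)** AS DEFINITIONS WITH BODIES at the level of expressions (printed objects as parameters), the
three printed localization prescriptions as PARTITIONS OF UNITY, the theorem that the localized pieces sum back to the
expression, and the IDENTIFICATION of print's own localized expression where print consumes it: **(3.9)** p. 435, *"where g, g′
are localization functions"*

statement-level skeleton of published theorems with citation tags; proofs where landed; nothing here is a claim about
the Yang–Mills mass gap

PDF held: `paper:balaban1983-higgs-2-3-quantum-fields-finite-volume` (journal page = PDF page + 410); pp. 417, 420, 424–425, 435
[PDF 7, 10, 14–15, 25] re-read by this seat on the ×2 renders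
`run/shared/lean/pub/pub-balaban/b2b-balaban-ref1/pages/1983-cmp88-higgs23-III/1983-cmp88-higgs23-III-p010,p014,p015,p025-x2.png`
(2026-08-23).

CITATION HEADER (lean-in-tree rule).  lit-balaban TYPED SKELETON (HOME `run/shared/lean/pub/lit-balaban/`), PHASE 2, seat p26 gen 40
(unit `lit-balaban-p26`; TAKING line HOME/STATUS.md 2026-08-23T09:17Z); free target named by the fold owner r15 g15 in
`B3-CLOSURE.md` v1.32 §5 item 19 for row **B3.Def@420** of `HOME/lit-balaban-r15/ROWS-B3.md` (verbatim: *"E(G,{□(v)},Φ_ext,A_ext) is a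
FIELD of the abstract carrier `B3Prop1.Expansion`, no body at print's generality — the model-level body is p26's `LocPicture.amp`:
FREE TARGET M = a concrete `Expansion`-level E with body for the typed classes, or the identification theorem that p26's `amp`
instantiates the field where print consumes it"*); cells only, the head is the owner's / the lead's call.  CONSUMES BY NAME: this
lineage's `B3Eq37Pictures.LocPicture`/`LocPicture.amp`/`pic36a`/`pic37a`/`kernel2`/`amp_pic36a_pic37a_sigma39` (p342619), r15's (3.9)
`B3Sect3ScalarSelfEnergy.coeff39`/`graphTerm39`/`counterTerm39`/`expr39` (p244358 …), this lineage's kernel `B3Eq330Members.sigma39`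
(p337803), p33 g62's smooth partition of unity `B3SmoothLocalization420.chi`/`corners`/`sum_chi` (p351018), the (Higgs)₂,₃ block map and
unit cubes `HiggsAveraging.blockIter`/`blockK` and r15's k-block regions `B3Eq14AuxFunction.region` (the Ω₁ of (1.4)).  Nothing of r15's
carrier `B3Prop1.Expansion` is restated; the typed field `Expansion.E` stays the abstract interface of Proposition 1.

THE PRINTED TEXT (verbatim, p. 420 [PDF 10]).  *"The next thing we need is a further localization in the vertices. For the vertices
(1.6) and (1.7) we localize simply by representing Ω₁ as a sum of unit cubes of the η-lattice. For the remaining vertices we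
localize, taking for each leg of the vector field a smooth partition of unity satisfying the condition that a support of each
function is contained in a cube with sides of length 2. We perform this localization for the terms of δm²_k(e(L^kε)g_k, λ(L^kε),
Ω₁, x), E_k(e(L^kε)g_k, λ(L^kε), Ω₁) also. The expressions (1.12)–(1.15) are localized by fixing a point y ∈ T₁^{(k)}∩Ω, or the unit
cube B^k(y). Thus with each expression there is connected some localization {□(v)}_{v∈G} (v is a vertex of a graph G corresponding
to this expression). … Let us denote by E(G, {□(v)}_{v∈G}, Φ_ext, A_ext) the expression corresponding to graph G with localizations
{□(v)}_{v∈G} and external fields Φ_ext, A_ext. The same symbol with G_ren instead of G denotes a sum of these expressions for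
G ∈ G_ren."*; p. 435 [PDF 25], (3.9): *"The expression corresponding to (3.8) is − Σ_{x,x′} η^{2d}φ(x)·[Σ_{μ=1}^d q(∂^η_μG_{(j)}(0)
∂^{η*}_μ)(x,x′)qg(x)G_{(j′)}(x,x′)g′(x′)]φ′(x′) + Σ_{x,x′} η^{2d}φ(x)·[…]φ′(x), (3.9) where g, g′ are localization functions."*;
p. 417 [PDF 7]: *"δm²_G … will be represented by the same graph G but with both external legs localized in x and with the summation
over x′."*

READING (declared; this file's typing of a prose definition — print gives no formula for E).  The expression of a graph G of the
perturbation expansion, BEFORE localization, is a finite sum over the positions `xs : V → X` of its vertices (`V` = the vertices of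
G, `X` = the sites of the lattice carrying them) of a summand `F(xs)` (the product of the vertex factors (1.6)–(1.15), the
propagators of the lines at `(xs v, xs v′)`, the external fields at the localization vertices of their legs — p. 417 — all of
which this file keeps as the PARAMETER `F`).  Each of the three printed prescriptions REWRITES the sum over the positions of ONE
vertex as a sum over a finite index of localizations `c` of a WEIGHT `w_c(x)` with `Σ_c w_c(x) = 1` at every site `x`:
(i) *"representing Ω₁ as a sum of unit cubes"* — `w_c = ` the indicator of the cube `c` (the fibre of the block map, `fiberWeight`);
(ii) *"a smooth partition of unity … support … in a cube with sides of length 2"* — `w_c = χ_c` (p33 g62's `chi`, `sum_chi`);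
(iii) *"fixing a point y"* — `w_y = ` the point mass at `y` (`fiberWeight id`).  Hence **E(G, {□(v)}_{v∈G}, Φ, A) := Σ_xs (Π_v
w_{□(v)}(xs v))·F(xs)** (`locSum`) — one weight per vertex — and the sentence *"Thus with each expression there is connected some
localization"* becomes the THEOREM `sum_locSum_eq`: summed over all assignments `v ↦ □(v)` the localized expressions give back
`Σ_xs F(xs)`, for ANY choice, vertex by vertex, among partitions of unity (the three prescriptions may be mixed, as print does).
E(G_ren, ·) is the printed signed sum over the class (`classExpr`, coefficients e.g. the `(−1)` of (3.7) or the `−a_k`, `−½a_k` of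
(1.18)), on a common vertex set (p. 417: the counterterm of G₀ is *"the same graph … with the summation over x′"*, so every member
of a class is drawn on the vertices of G; p. 432: *"localizations in these graphs should be in agreement"*).

WHAT IS TYPED / PROVED (definitions with bodies + theorems; no `Prop` fact, no `sorry`; standard axioms).
§1 (generic: `V`, `X` finite types) `locWeight`, **`locSum`**, `locSum_one` (all weights 1 = the unlocalized expression), linearity
(`locSum_add`, `locSum_smul`, `locSum_neg`, `locSum_sub`); `IsPartition` (Σ_c ρ_c(x) = 1); **`sum_locWeight_eq_one`** and
**`sum_locSum_eq`** (Σ over all localizations of the localized expression = the expression; `Fintype.prod_sum`); the prescriptions: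
`fiberWeight` with `isPartition_fiber` ((i) cubes = fibres of a block map, (iii) points = fibres of `id`), **`locSum_fiber`** (cube
localization = the position sum RESTRICTED to `xs v ∈ □(v)` — the form of p19's amplitude model `B3Ineq213Amplitude.Amp.E`,
*"Σ_{x_v ∈ □(v)}"*), `locSum_point` (point localization at every vertex = evaluation), and (ii) **`isPartition_chi`**: p33's smooth
partition of unity `χ_c`, `c ∈ corners k`, IS a partition in this sense (`sum_chi` by name, on the (Higgs)₂,₃ torus carrier of record);
§2 `classExpr` (E(G_ren) := Σ_{G∈G_ren} c_G E(G)), `locSum_classExpr` (localization is linear over the class), `sum_locSum_classExpr`;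
§3 ON THIS LINEAGE'S PICTURES (p. 417 dictionary): **`ampW`** = `LocPicture.amp` with one weight per vertex, `ampW_eq_locSum`,
**`ampW_one`** (= `amp`), **`sum_ampW_eq_amp`**; §4 THE IDENTIFICATION AT (3.9): `coeff39_factor`/`sigma39_factor` (print's bracket with
g, g′ = g(x)g′(x′) × the bracket with g = g′ = 1), **`graphTerm39_eq_ampW`** / **`counterTerm39_eq_ampW`** (r15's two terms of (3.9) ARE
the weighted expressions of the drawn pictures (3.6)₁ / (3.7)₁ with the weights `w39 g g′ = (g at x, g′ at x′)` and the unweighted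
kernel `sigma39 … 1 1`), **`expr39_eq_ampW`**, and the localization theorem for print's own expression: **`sum_graphTerm39_eq`**,
**`sum_counterTerm39_eq`**, **`sum_expr39_eq`** — for any two partitions of unity `(g_c)_c`, `(g′_{c′})_{c′}`,
`Σ_{c,c′} expr39 η q G G′ g_c g′_{c′} φ φ′ = expr39 η q G G′ 1 1 φ φ′`: (3.9) is E((3.8), {□(x), □(x′)}, φ, φ′) and the localized
pieces sum back to the expression of (3.8); §5 THE CLASS (3.8) = {(+1, (3.6)₁), (−1, (3.7)₁)} as a `classExpr` on the common vertex
set {x, x′} (`class38`, `summand36`/`summand37`): `locSum_class38` (= localized graph term − localized counterterm),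
**`expr39_eq_neg_locSum_class38`** ((3.9) = −E((3.8), {g, g′})), `sum_locSum_class38_eq` (summed over localizations = `amp` − `amp`).
(§1 also records prescription (i) in the tree's cube vocabulary: `fiberWeight_blockIter` — the fibres of `HiggsAveraging.blockIter k`
are the unit cubes `blockK k y` —, `isPartition_cubes`, `locSum_cubes`, and **Ω₁'s k-block structure** (the lead's Q23 clause for
B3.Eq1.4): `sum_locSum_cubes_region` — with Ω₁ = r15's `B3Eq14AuxFunction.region k Λ` (a union of k-blocks) the cube localizations
indexed by `y ∈ Λ` at every (1.6)/(1.7) vertex sum to the position sum restricted to Ω₁.)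
HONEST SCOPE.  (a) `F`, the weights and the coefficients are parameters: this file does not construct the summand of a general
graph from the catalogue (1.6)–(1.15) (the tree's evaluators are per picture: `LocPicture.amp` with a caller-supplied kernel, r15's
(3.9)/(3.23)/(3.26) expressions, p19's amplitude model); it types the LOCALIZATION STEP of p. 420 and the class sum, and identifies
them on (3.9).  (b) The smooth prescription (ii) is instantiated through p33's `chi` on the (Higgs)₂,₃ carrier `HiggsLattice.Site P 0`;
the pictures of §3–§4 live on the carrier of r15's Sect. 3 files (`Setup.Site P j`); the generic §1 serves both.  (c) r15's abstract
field `B3Prop1.Expansion.E` is not instantiated here (its companions `treeLen`, `normS`, `normV` are other rows' objects); the owner /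
the lead decide what the head of B3.Def@420 needs.  Unit `lit-balaban-p26` gen 40 (literature-prover-lit-balaban-p26-g40-0), HOME
`run/shared/lean/pub/lit-balaban/`, 2026-08-23.
-/

open Finset
open scoped BigOperators

namespace Literature.MathematicalPhysics.QuantumFieldTheory.Balaban1983to89.B3LocalizedExpression420

/-! ## §1 Localized expressions: one weight per vertex; partitions of unity; the localization theorem -/

section Generic

variable {V X : Type*}

/-- The weight of a position tuple `xs : V → X` under a localization `w` (one weight function `w v : X → ℝ` per vertex `v` — the
indicator of `□(v)`, a smooth partition member, or a point mass, p. 420): `Π_v w_v(xs v)`. [cite: Balaban1983Higgs3, p.420] -/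
def locWeight [Fintype V] (w : V → X → ℝ) (xs : V → X) : ℝ := ∏ v, w v (xs v)

/-- **E(G, {□(v)}_{v∈G}, Φ_ext, A_ext)** p. 420 [PDF 10], verbatim: *"Let us denote by E(G, {□(v)}_{v∈G}, Φ_ext, A_ext) the expression
corresponding to graph G with localizations {□(v)}_{v∈G} and external fields Φ_ext, A_ext"* — typed at the level of expressions: for the
summand `F` of the graph's position sum (vertex factors, propagators, external fields: a parameter) and the localization `w` (one
weight per vertex), `E := Σ_{xs : V → X} (Π_v w_v(xs v))·F(xs)`. [cite: Balaban1983Higgs3, p.420] -/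
def locSum [Fintype V] [DecidableEq V] [Fintype X] (w : V → X → ℝ) (F : (V → X) → ℝ) : ℝ :=
  ∑ xs : V → X, locWeight w xs * F xs

/-- With all weights equal to `1` the localized expression is the expression itself, `Σ_xs F(xs)`. [cite: Balaban1983Higgs3, p.420] -/
theorem locSum_one [Fintype V] [DecidableEq V] [Fintype X] (F : (V → X) → ℝ) :
    locSum (fun (_ : V) (_ : X) => (1 : ℝ)) F = ∑ xs : V → X, F xs := by
  simp [locSum, locWeight]

/-- Localization is additive in the summand. [cite: Balaban1983Higgs3, p.420] -/
theorem locSum_add [Fintype V] [DecidableEq V] [Fintype X] (w : V → X → ℝ) (F F' : (V → X) → ℝ) :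
    locSum w (fun xs => F xs + F' xs) = locSum w F + locSum w F' := by
  simp only [locSum, mul_add, sum_add_distrib]

/-- Localization is homogeneous in the summand. [cite: Balaban1983Higgs3, p.420] -/
theorem locSum_smul [Fintype V] [DecidableEq V] [Fintype X] (w : V → X → ℝ) (a : ℝ) (F : (V → X) → ℝ) :
    locSum w (fun xs => a * F xs) = a * locSum w F := by
  simp only [locSum, mul_sum]
  exact sum_congr rfl fun xs _ => by ring

/-- Localization commutes with negation of the summand. [cite: Balaban1983Higgs3, p.420] -/
theorem locSum_neg [Fintype V] [DecidableEq V] [Fintype X] (w : V → X → ℝ) (F : (V → X) → ℝ) :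
    locSum w (fun xs => -F xs) = -locSum w F := by
  simp only [locSum, mul_neg, sum_neg_distrib]

/-- Localization commutes with differences of summands (graph term minus counterterm, (3.8)). [cite: Balaban1983Higgs3, (3.8) p.435] -/
theorem locSum_sub [Fintype V] [DecidableEq V] [Fintype X] (w : V → X → ℝ) (F F' : (V → X) → ℝ) :
    locSum w (fun xs => F xs - F' xs) = locSum w F - locSum w F' := by
  simp only [locSum, mul_sub, sum_sub_distrib]

/-- **A partition of unity** on the sites, indexed by a finite type `C` of localizations: `Σ_c ρ_c(x) = 1` at every site — the common
shape of the three prescriptions of p. 420 (unit cubes, *"a smooth partition of unity"*, points). [cite: Balaban1983Higgs3, p.420] -/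
def IsPartition {C : Type*} [Fintype C] (ρ : C → X → ℝ) : Prop := ∀ x : X, ∑ c, ρ c x = 1

/-- kernel: for partitions of unity `ρ_v` at every vertex, the weights of ONE position tuple summed over all assignments
`c : v ↦ c_v` of localizations equal `1`: `Σ_c Π_v ρ_{v,c_v}(xs v) = Π_v Σ_{c_v} ρ_{v,c_v}(xs v) = 1`. [cite: Balaban1983Higgs3, p.420] -/
theorem sum_locWeight_eq_one [Fintype V] [DecidableEq V] {C : V → Type*} [∀ v, Fintype (C v)]
    (ρ : (v : V) → C v → X → ℝ) (hρ : ∀ v, IsPartition (ρ v)) (xs : V → X) :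
    ∑ c : (v : V) → C v, locWeight (fun v => ρ v (c v)) xs = 1 := by
  unfold locWeight
  calc ∑ c : (v : V) → C v, ∏ v, ρ v (c v) (xs v)
      = ∏ v, ∑ cv : C v, ρ v cv (xs v) := (Fintype.prod_sum fun v cv => ρ v cv (xs v)).symm
    _ = 1 := prod_eq_one fun v _ => hρ v (xs v)

/-- **p. 420, *"Thus with each expression there is connected some localization {□(v)}_{v∈G}"*, AS A THEOREM**: when every vertex `v` is
localized by a partition of unity `ρ_v` (indexed by its own finite set `C v` of localizations — cubes for (1.6)/(1.7), partition
members for the vector-leg vertices, points for (1.12)–(1.15), freely mixed), the localized expressions summed over all assignments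
`{□(v)}_{v∈G}` give back the expression: `Σ_{c} E(G, {c_v}, Φ, A) = Σ_xs F(xs)`. [cite: Balaban1983Higgs3, p.420] -/
theorem sum_locSum_eq [Fintype V] [DecidableEq V] [Fintype X] {C : V → Type*} [∀ v, Fintype (C v)]
    (ρ : (v : V) → C v → X → ℝ) (hρ : ∀ v, IsPartition (ρ v)) (F : (V → X) → ℝ) :
    ∑ c : (v : V) → C v, locSum (fun v => ρ v (c v)) F = ∑ xs : V → X, F xs := by
  unfold locSum
  rw [sum_comm]
  refine sum_congr rfl fun xs _ => ?_
  rw [← sum_mul, sum_locWeight_eq_one ρ hρ xs, one_mul]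

/-- **Prescriptions (i) and (iii) of p. 420**: the indicator weights of the fibres of a map `f : X → Y` — (i) `f` = the block map of
the η-lattice onto the unit lattice, fibres = *"unit cubes of the η-lattice"*; (iii) `f = id`, fibres = points, *"localized by fixing a
point y"*. [cite: Balaban1983Higgs3, p.420] -/
def fiberWeight {Y : Type*} [DecidableEq Y] (f : X → Y) (y : Y) (x : X) : ℝ := if f x = y then 1 else 0

/-- The fibre indicators of any map form a partition of unity (every site lies in exactly one cube / is exactly one point).
[cite: Balaban1983Higgs3, p.420] -/
theorem isPartition_fiber {Y : Type*} [Fintype Y] [DecidableEq Y] (f : X → Y) : IsPartition (fiberWeight f) := by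
  intro x
  simp [fiberWeight]

/-- **Cube (or point) localization = the RESTRICTED position sum**: with the indicator weights of the cubes `c_v = □(v)` the localized
expression is `Σ_{xs : xs v ∈ □(v) ∀ v} F(xs)` — the form *"Σ_{x_v ∈ □(v)}"* in which p19's amplitude model writes E(G(j), {□(v)}, …)
(`B3Ineq213Amplitude.Amp.E`, (2.13) p. 426). [cite: Balaban1983Higgs3, p.420] [cite: Balaban1983Higgs3, (2.13) p.426] -/
theorem locSum_fiber [Fintype V] [DecidableEq V] [Fintype X] {Y : Type*} [DecidableEq Y] (f : X → Y) (c : V → Y)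
    (F : (V → X) → ℝ) :
    locSum (fun v => fiberWeight f (c v)) F = ∑ xs ∈ univ.filter (fun xs : V → X => ∀ v, f (xs v) = c v), F xs := by
  unfold locSum locWeight fiberWeight
  rw [sum_filter]
  refine sum_congr rfl fun xs _ => ?_
  by_cases h : ∀ v, f (xs v) = c v
  · rw [if_pos h, prod_eq_one fun v _ => if_pos (h v), one_mul]
  · rw [if_neg h]
    obtain ⟨v, hv⟩ := not_forall.mp h
    rw [prod_eq_zero (mem_univ v) (if_neg hv), zero_mul]

/-- **Prescription (iii) at every vertex**: localizing every vertex at a point, `□(v) = {y_v}`, the localized expression is the single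
summand `F(y)`. [cite: Balaban1983Higgs3, p.420] -/
theorem locSum_point [Fintype V] [DecidableEq V] [Fintype X] [DecidableEq X] (y : V → X) (F : (V → X) → ℝ) :
    locSum (fun v => fiberWeight id (y v)) F = F y := by
  rw [locSum_fiber]
  have hfilter : univ.filter (fun xs : V → X => ∀ v, id (xs v) = y v) = {y} := by
    ext xs
    simp only [mem_filter, mem_univ, true_and, id_eq, mem_singleton]
    exact ⟨fun h => funext h, fun h v => h ▸ rfl⟩
  rw [hfilter, sum_singleton]

end Generic

/-! ### Prescription (ii): p33's smooth partition of unity on the torus carrier of record -/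

section Smooth

open B3SmoothLocalization420 (chi corners sum_chi)

variable {P : HiggsLattice.Params} {k : ℕ}

/-- **Prescription (ii) of p. 420** in the tree: p33 g62's smooth partition of unity `χ_c`, `c ∈ corners k` (supports in cubes of
side 2, `B3SmoothLocalization420.sum_chi`: Σ_c χ_c(x) = 1 on T_ε, `k ≤ K`) IS a partition of unity in the sense of `IsPartition`
(indexed by the finite type of cube-aligned corners). [cite: Balaban1983Higgs3, p.420] -/
theorem isPartition_chi (hk : k ≤ P.K) :
    IsPartition (fun (c : corners (P := P) k) (x : HiggsLattice.Site P 0) => chi k (c : HiggsLattice.Site P 0) x) := by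
  intro x
  have h := sum_chi hk x
  rw [← sum_coe_sort] at h
  exact h

/-- Consequently a graph all of whose vertices are vector-leg vertices localized by print's smooth partition has its expression
recovered from the localized pieces: `Σ_{c : V → corners} E(G, {χ_{c_v}}, …) = Σ_xs F(xs)` on `T_ε`. [cite: Balaban1983Higgs3, p.420] -/
theorem sum_locSum_chi_eq {V : Type*} [Fintype V] [DecidableEq V] (hk : k ≤ P.K)
    (F : (V → HiggsLattice.Site P 0) → ℝ) :
    ∑ c : V → corners (P := P) k, locSum (fun v x => chi k (c v : HiggsLattice.Site P 0) x) F =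
      ∑ xs : V → HiggsLattice.Site P 0, F xs :=
  sum_locSum_eq (C := fun _ : V => corners (P := P) k)
    (fun (_ : V) (c : corners (P := P) k) (x : HiggsLattice.Site P 0) => chi k (c : HiggsLattice.Site P 0) x)
    (fun _ => isPartition_chi hk) F

end Smooth

/-! ### Prescription (i) in the tree's cube vocabulary: the unit cubes `B^k(y)` are the fibres of the block map -/

section Cubes

open HiggsAveraging (blockIter blockK mem_blockK)
open B3Eq14AuxFunction (region mem_region)

variable {P : HiggsLattice.Params} {k : ℕ}

/-- **Prescription (i) of p. 420 in the tree's vocabulary**: the indicator weight of the fibre `y` of the `k`-fold block map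
`HiggsAveraging.blockIter k : T_ε → T^{(k)}` is the indicator of the unit cube `B^k(y)` of the η-lattice (`HiggsAveraging.blockK`, the
cubes of the typer's *"Ω₁ as a sum of unit cubes"* `B3Eq18VertexExpansion.sum_region_eq_sum_blocks`). [cite: Balaban1983Higgs3, p.420] -/
theorem fiberWeight_blockIter (y : HiggsLattice.Site P k) (x : HiggsLattice.Site P 0) :
    fiberWeight (blockIter k) y x = if x ∈ blockK k y then 1 else 0 := by
  unfold fiberWeight
  exact if_congr (mem_blockK k y x).symm rfl rfl

/-- The unit cubes form a partition of unity of `T_ε` (every site lies in exactly one cube `B^k(y)`). [cite: Balaban1983Higgs3, p.420] -/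
theorem isPartition_cubes : IsPartition (fiberWeight (blockIter (P := P) k)) :=
  isPartition_fiber _

/-- **Cube localization of every vertex = the position sum restricted to `x_v ∈ B^k(y_v)`** (all vertices of the kind (1.6)/(1.7)).
[cite: Balaban1983Higgs3, p.420] -/
theorem locSum_cubes {V : Type*} [Fintype V] [DecidableEq V] (y : V → HiggsLattice.Site P k)
    (F : (V → HiggsLattice.Site P 0) → ℝ) :
    locSum (fun v => fiberWeight (blockIter k) (y v)) F =
      ∑ xs ∈ univ.filter (fun xs : V → HiggsLattice.Site P 0 => ∀ v, xs v ∈ blockK k (y v)), F xs := by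
  rw [locSum_fiber]
  refine sum_congr ?_ fun _ _ => rfl
  ext xs
  simp only [mem_filter, mem_univ, true_and, mem_blockK]

/-- **Ω₁'s k-block structure at p. 420** (the lead's Q23 clause for B3.Eq1.4: *"Ω₁'s k-block structure consumed at p. 420"*): with
Ω₁ = B^k(Λ) a union of k-blocks — r15's `B3Eq14AuxFunction.region k Λ`, the Ω₁ = B^k(Λ₇^{(k−1)′}) of (1.4) — localizing EVERY vertex
of the kind (1.6)/(1.7) in the unit cubes `B^k(y)`, `y ∈ Λ` (*"representing Ω₁ as a sum of unit cubes of the η-lattice"*) and summing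
over the assignments `c : V → Λ` gives exactly the position sum restricted to `x_v ∈ Ω₁` for all `v` (the typer's one-vertex identity
`B3Eq18VertexExpansion.sum_region_eq_sum_blocks` for several vertices at once, in the weight language).
[cite: Balaban1983Higgs3, p.420] [cite: Balaban1983Higgs3, (1.4) p.412] -/
theorem sum_locSum_cubes_region {V : Type*} [Fintype V] [DecidableEq V] (Λ : Finset (HiggsLattice.Site P k))
    (F : (V → HiggsLattice.Site P 0) → ℝ) :
    ∑ c : V → Λ, locSum (fun v => fiberWeight (blockIter k) (c v : HiggsLattice.Site P k)) F =
      ∑ xs ∈ univ.filter (fun xs : V → HiggsLattice.Site P 0 => ∀ v, xs v ∈ region k Λ), F xs := by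
  unfold locSum
  rw [sum_comm, sum_filter]
  refine sum_congr rfl fun xs _ => ?_
  rw [← sum_mul]
  by_cases h : ∀ v, xs v ∈ region k Λ
  · rw [if_pos h]
    have hmem : ∀ v, blockIter k (xs v) ∈ Λ := fun v => (mem_region k Λ (xs v)).1 (h v)
    let c₀ : V → Λ := fun v => ⟨blockIter k (xs v), hmem v⟩
    rw [sum_eq_single c₀]
    · unfold locWeight fiberWeight
      rw [prod_eq_one fun v _ => if_pos rfl, one_mul]
    · intro c _ hc
      obtain ⟨v, hv⟩ := Function.ne_iff.mp hc
      unfold locWeight fiberWeight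
      refine prod_eq_zero (mem_univ v) (if_neg fun e => hv (Subtype.ext ?_))
      exact e.symm
    · intro hc₀
      exact absurd (mem_univ c₀) hc₀
  · rw [if_neg h]
    obtain ⟨v, hv⟩ := not_forall.mp h
    have hv' : blockIter k (xs v) ∉ Λ := fun hh => hv ((mem_region k Λ (xs v)).2 hh)
    refine mul_eq_zero_of_left (sum_eq_zero fun c _ => ?_) (F xs)
    unfold locWeight fiberWeight
    refine prod_eq_zero (mem_univ v) (if_neg fun e => hv' ?_)
    rw [e]
    exact (c v).2

end Cubes


/-! ## §2 E(G_ren, …): the signed sum over a renormalized class -/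

section Classes

variable {V X ι : Type*}

/-- **E(G_ren, {□(v)}, Φ_ext, A_ext)** p. 420 [PDF 10], verbatim: *"The same symbol with G_ren instead of G denotes a sum of these
expressions for G ∈ G_ren"* — the summand of a renormalized class: the signed sum `Σ_{G∈G_ren} c_G F_G` of the summands of its members
(coefficients as printed with the class, e.g. `(−1)` in (3.7), `−a_k` / `−½a_k` in (1.18)), all drawn on the vertex set of G (p. 417:
a counterterm is *"represented by the same graph … with the summation over x′"*). [cite: Balaban1983Higgs3, p.420] -/
def classExpr (s : Finset ι) (coef : ι → ℝ) (F : ι → (V → X) → ℝ) : (V → X) → ℝ :=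
  fun xs => ∑ i ∈ s, coef i * F i xs

/-- **E(G_ren, {□(v)}, …) = Σ_{G∈G_ren} c_G E(G, {□(v)}, …)**: localizing the class (localizations *"in agreement"*, p. 432 — one
assignment `{□(v)}` for the common vertex set) is localizing each member. [cite: Balaban1983Higgs3, p.420] -/
theorem locSum_classExpr [Fintype V] [DecidableEq V] [Fintype X] (w : V → X → ℝ) (s : Finset ι) (coef : ι → ℝ)
    (F : ι → (V → X) → ℝ) :
    locSum w (classExpr s coef F) = ∑ i ∈ s, coef i * locSum w (F i) := by
  unfold locSum classExpr
  simp_rw [mul_sum]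
  rw [sum_comm]
  exact sum_congr rfl fun i _ => sum_congr rfl fun xs _ => by ring

/-- The localization theorem for a class: summed over all localizations, the localized class expressions give back
`Σ_{G∈G_ren} c_G Σ_xs F_G(xs)`. [cite: Balaban1983Higgs3, p.420] -/
theorem sum_locSum_classExpr [Fintype V] [DecidableEq V] [Fintype X] {C : V → Type*} [∀ v, Fintype (C v)]
    (ρ : (v : V) → C v → X → ℝ) (hρ : ∀ v, IsPartition (ρ v)) (s : Finset ι) (coef : ι → ℝ) (F : ι → (V → X) → ℝ) :
    ∑ c : (v : V) → C v, locSum (fun v => ρ v (c v)) (classExpr s coef F) = ∑ i ∈ s, coef i * ∑ xs : V → X, F i xs := by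
  rw [sum_locSum_eq ρ hρ]
  unfold classExpr
  rw [sum_comm]
  exact sum_congr rfl fun i _ => by rw [mul_sum]

end Classes

/-! ## §3 The pictures of this lineage: `LocPicture.amp` with one weight per vertex -/

section Pictures

open B3Prop1 B3Cor23Concrete B3Sect3LowestOrderGraphs B3Eq37Pictures
open B3Sect3ScalarSelfEnergy B3Eq330Members

open scoped RealInnerProductSpace

noncomputable section

variable {nbar : ℕ} {P : Params} {j : ℕ} {W : Type*} [NormedAddCommGroup W] [InnerProductSpace ℝ W]

/-- **The localized expression of a picture** (p. 417 dictionary `LocPicture.amp` of this lineage, p. 420 localization): for a picture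
with two chosen external φ′-legs `e, e′`, a position kernel `K` and ONE WEIGHT `w v` PER VERTEX,
`Σ_{xs} η^{(#vertices)·d}·(Π_v w_v(xs v))·⟪φ(xs(loc e)), K(xs)φ′(xs(loc e′))⟫`. [cite: Balaban1983Higgs3, p.420] -/
def ampW (Pic : LocPicture nbar) (e e' : Leg Pic.G.kind) (η : ℝ) (w : Fin Pic.G.nV → Site P j → ℝ)
    (K : (Fin Pic.G.nV → Site P j) → W →ₗ[ℝ] W) (φ φ' : SiteField P j W) : ℝ :=
  ∑ xs : Fin Pic.G.nV → Site P j,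
    η ^ (Pic.G.nV * P.d) * locWeight w xs * ⟪φ (xs (Pic.loc e)), K xs (φ' (xs (Pic.loc e')))⟫

/-- `ampW` is the localized expression `locSum` of the picture's summand. [cite: Balaban1983Higgs3, p.420] -/
theorem ampW_eq_locSum (Pic : LocPicture nbar) (e e' : Leg Pic.G.kind) (η : ℝ) (w : Fin Pic.G.nV → Site P j → ℝ)
    (K : (Fin Pic.G.nV → Site P j) → W →ₗ[ℝ] W) (φ φ' : SiteField P j W) :
    ampW Pic e e' η w K φ φ' =
      locSum w fun xs => η ^ (Pic.G.nV * P.d) * ⟪φ (xs (Pic.loc e)), K xs (φ' (xs (Pic.loc e')))⟫ := by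
  unfold ampW locSum
  exact sum_congr rfl fun xs _ => by ring

/-- **With all weights `1`, `ampW` is this lineage's `LocPicture.amp`** (the unlocalized expression of the picture).
[cite: Balaban1983Higgs3, p.417] -/
theorem ampW_one (Pic : LocPicture nbar) (e e' : Leg Pic.G.kind) (η : ℝ) (K : (Fin Pic.G.nV → Site P j) → W →ₗ[ℝ] W)
    (φ φ' : SiteField P j W) :
    ampW Pic e e' η (fun _ _ => 1) K φ φ' = Pic.amp e e' η K φ φ' := by
  unfold ampW LocPicture.amp locWeight
  exact sum_congr rfl fun xs _ => by simp

/-- **The localization theorem for pictures**: localizing every vertex of a picture by a partition of unity and summing over all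
assignments gives back `LocPicture.amp`. [cite: Balaban1983Higgs3, p.420] -/
theorem sum_ampW_eq_amp (Pic : LocPicture nbar) (e e' : Leg Pic.G.kind) (η : ℝ) {C : Fin Pic.G.nV → Type*}
    [∀ v, Fintype (C v)] (ρ : (v : Fin Pic.G.nV) → C v → Site P j → ℝ) (hρ : ∀ v, IsPartition (ρ v))
    (K : (Fin Pic.G.nV → Site P j) → W →ₗ[ℝ] W) (φ φ' : SiteField P j W) :
    ∑ c : (v : Fin Pic.G.nV) → C v, ampW Pic e e' η (fun v => ρ v (c v)) K φ φ' = Pic.amp e e' η K φ φ' := by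
  simp only [ampW_eq_locSum]
  rw [sum_locSum_eq ρ hρ]
  rfl

/-! ## §4 The identification at (3.9): *"where g, g′ are localization functions"* -/

/-- **The bracket of (3.9) FACTORS through the localization functions**: r15's `coeff39 η G G′ g g′ (x, x′) = g(x)·g′(x′)·coeff39 η G
G′ 1 1 (x, x′)` — g and g′ enter (3.9) exactly as one weight per vertex. [cite: Balaban1983Higgs3, (3.9) p.435] -/
theorem coeff39_factor (η : ℝ) (Gj Gj' : Kernel P j) (g g' : SiteField P j ℝ) (x x' : Site P j) :
    coeff39 η Gj Gj' g g' x x' = g x * g' x' * coeff39 η Gj Gj' 1 1 x x' := by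
  unfold coeff39
  simp only [Pi.one_apply]
  ring

/-- The same for this lineage's kernel `Σ₃₉ = coeff39 • q²` of the drawn graph (3.6)₁. [cite: Balaban1983Higgs3, (3.9) p.435] -/
theorem sigma39_factor (η : ℝ) (q : W →ₗ[ℝ] W) (Gj Gj' : Kernel P j) (g g' : SiteField P j ℝ) (x x' : Site P j) :
    sigma39 η q Gj Gj' g g' x x' = (g x * g' x') • sigma39 η q Gj Gj' 1 1 x x' := by
  unfold sigma39
  rw [coeff39_factor, smul_smul]

/-- **The localization of the two vertices of (3.6)₁ / (3.7)₁ by print's functions**: `g` at the vertex `x = 0`, `g′` at `x′ = 1`.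
[cite: Balaban1983Higgs3, (3.9) p.435] -/
def w39 (g g' : SiteField P j ℝ) : Fin 2 → Site P j → ℝ := ![g, g']

/-- the weight of a position pair under `w39 g g′` is `g(x)·g′(x′)`. [cite: Balaban1983Higgs3, (3.9) p.435] -/
theorem locWeight_w39 (g g' : SiteField P j ℝ) (xs : Fin 2 → Site P j) :
    locWeight (w39 g g') xs = g (xs 0) * g' (xs 1) := by
  unfold locWeight w39
  rw [Fin.prod_univ_two]
  simp

/-- kernel: print's kernel with `g, g′` is the weight of the position pair times the kernel without them.
[cite: Balaban1983Higgs3, (3.9) p.435] -/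
private theorem kernel2_sigma39_eq (η : ℝ) (q : W →ₗ[ℝ] W) (Gj Gj' : Kernel P j) (g g' : SiteField P j ℝ)
    (xs : Fin 2 → Site P j) :
    kernel2 (sigma39 η q Gj Gj' g g') xs = locWeight (w39 g g') xs • kernel2 (sigma39 η q Gj Gj' 1 1) xs := by
  unfold kernel2
  rw [sigma39_factor, locWeight_w39]

variable (hn : 1 ≤ nbar)

/-- **r15's graph term of (3.9) IS the localized expression of the drawn picture (3.6)₁** with print's localization functions as the
vertex weights (`g` at `x`, `g′` at `x′`) and the kernel `Σ₃₉` taken WITHOUT them. [cite: Balaban1983Higgs3, (3.9) p.435] -/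
theorem graphTerm39_eq_ampW (η : ℝ) (q : W →ₗ[ℝ] W) (Gj Gj' : Kernel P j) (g g' : SiteField P j ℝ) (φ φ' : SiteField P j W) :
    graphTerm39 η q Gj Gj' g g' φ φ' =
      ampW (pic36a hn) (sLeg 0 1) (sLeg 1 1) η (w39 g g') (kernel2 (sigma39 η q Gj Gj' 1 1)) φ φ' := by
  rw [← (amp_pic36a_pic37a_sigma39 hn η q Gj Gj' g g' φ φ').1]
  unfold ampW LocPicture.amp
  show ∑ xs : Fin 2 → Site P j, η ^ (2 * P.d) * ⟪φ (xs 0), kernel2 (sigma39 η q Gj Gj' g g') xs (φ' (xs 1))⟫ =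
    ∑ xs : Fin 2 → Site P j, η ^ (2 * P.d) * locWeight (w39 g g') xs *
      ⟪φ (xs 0), kernel2 (sigma39 η q Gj Gj' 1 1) xs (φ' (xs 1))⟫
  refine sum_congr rfl fun xs _ => ?_
  rw [kernel2_sigma39_eq, LinearMap.smul_apply, real_inner_smul_right]
  ring

/-- **r15's counterterm of (3.9) IS the localized expression of the counterterm picture (3.7)₁** (both external legs at `x`, p. 417)
with the same weights and kernel. [cite: Balaban1983Higgs3, (3.9) p.435] -/
theorem counterTerm39_eq_ampW (η : ℝ) (q : W →ₗ[ℝ] W) (Gj Gj' : Kernel P j) (g g' : SiteField P j ℝ)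
    (φ φ' : SiteField P j W) :
    counterTerm39 η q Gj Gj' g g' φ φ' =
      ampW (pic37a hn) (sLeg 0 1) (sLeg 1 1) η (w39 g g') (kernel2 (sigma39 η q Gj Gj' 1 1)) φ φ' := by
  rw [← (amp_pic36a_pic37a_sigma39 hn η q Gj Gj' g g' φ φ').2]
  unfold ampW LocPicture.amp
  rw [pic37a_loc, pic37a_loc, loc37_ext.1, loc37_ext.2]
  show ∑ xs : Fin 2 → Site P j, η ^ (2 * P.d) * ⟪φ (xs 0), kernel2 (sigma39 η q Gj Gj' g g') xs (φ' (xs 0))⟫ =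
    ∑ xs : Fin 2 → Site P j, η ^ (2 * P.d) * locWeight (w39 g g') xs *
      ⟪φ (xs 0), kernel2 (sigma39 η q Gj Gj' 1 1) xs (φ' (xs 0))⟫
  refine sum_congr rfl fun xs _ => ?_
  rw [kernel2_sigma39_eq, LinearMap.smul_apply, real_inner_smul_right]
  ring

/-- **(3.9) = E((3.8), {□(x), □(x′)}, φ, φ′)**: r15's `expr39` with the localization functions `g, g′` is minus the localized
expression of the formal difference (3.8) = [(3.6)₁] − [(3.7)₁'s picture] (the exterior sign of (3.9), cf. `expr39_eq_neg_amp_pic38`).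
[cite: Balaban1983Higgs3, (3.9) p.435] -/
theorem expr39_eq_ampW (η : ℝ) (q : W →ₗ[ℝ] W) (Gj Gj' : Kernel P j) (g g' : SiteField P j ℝ) (φ φ' : SiteField P j W) :
    expr39 η q Gj Gj' g g' φ φ' =
      -(ampW (pic36a hn) (sLeg 0 1) (sLeg 1 1) η (w39 g g') (kernel2 (sigma39 η q Gj Gj' 1 1)) φ φ' -
        ampW (pic37a hn) (sLeg 0 1) (sLeg 1 1) η (w39 g g') (kernel2 (sigma39 η q Gj Gj' 1 1)) φ φ') := by
  unfold expr39
  rw [graphTerm39_eq_ampW hn, counterTerm39_eq_ampW hn]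
  ring

/-! ### The localized pieces of (3.9) sum back to the expression of (3.8) -/

/-- kernel: a double sum of products of two partitions of unity against a fixed two-point summand collapses,
`Σ_{c,c′} Σ_{x,x′} ρ_c(x)ρ′_{c′}(x′)T(x,x′) = Σ_{x,x′} T(x,x′)`. [cite: Balaban1983Higgs3, p.420] -/
private theorem sum_sum_partition₂ {C C' : Type*} [Fintype C] [Fintype C'] (ρ : C → SiteField P j ℝ)
    (ρ' : C' → SiteField P j ℝ) (hρ : IsPartition ρ) (hρ' : IsPartition ρ') (T : Site P j → Site P j → ℝ) :
    ∑ c, ∑ c', ∑ x : Site P j, ∑ x' : Site P j, ρ c x * ρ' c' x' * T x x' =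
      ∑ x : Site P j, ∑ x' : Site P j, T x x' := by
  have h1 : ∀ c, ∑ c', ∑ x : Site P j, ∑ x' : Site P j, ρ c x * ρ' c' x' * T x x' =
      ∑ x : Site P j, ∑ x' : Site P j, ρ c x * T x x' := by
    intro c
    rw [sum_comm]
    refine sum_congr rfl fun x _ => ?_
    rw [sum_comm]
    refine sum_congr rfl fun x' _ => ?_
    have e : ∑ c', ρ c x * ρ' c' x' * T x x' = ρ c x * T x x' * ∑ c', ρ' c' x' := by
      rw [mul_sum]
      exact sum_congr rfl fun c' _ => by ring
    rw [e, hρ' x', mul_one]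
  simp only [h1]
  rw [sum_comm]
  refine sum_congr rfl fun x _ => ?_
  rw [sum_comm]
  refine sum_congr rfl fun x' _ => ?_
  rw [← sum_mul, hρ x, one_mul]

/-- **The graph term of (3.9) localized by two partitions of unity sums back to the unlocalized graph term** (`g = g′ = 1`).
[cite: Balaban1983Higgs3, (3.9) p.435] -/
theorem sum_graphTerm39_eq {C C' : Type*} [Fintype C] [Fintype C'] (ρ : C → SiteField P j ℝ) (ρ' : C' → SiteField P j ℝ)
    (hρ : IsPartition ρ) (hρ' : IsPartition ρ') (η : ℝ) (q : W →ₗ[ℝ] W) (Gj Gj' : Kernel P j) (φ φ' : SiteField P j W) :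
    ∑ c, ∑ c', graphTerm39 η q Gj Gj' (ρ c) (ρ' c') φ φ' = graphTerm39 η q Gj Gj' 1 1 φ φ' := by
  unfold graphTerm39
  have h : ∀ c c', ∑ x : Site P j, ∑ x' : Site P j,
      η ^ (2 * P.d) * (coeff39 η Gj Gj' (ρ c) (ρ' c') x x' * ⟪φ x, q (q (φ' x'))⟫) =
      ∑ x : Site P j, ∑ x' : Site P j,
        ρ c x * ρ' c' x' * (η ^ (2 * P.d) * (coeff39 η Gj Gj' 1 1 x x' * ⟪φ x, q (q (φ' x'))⟫)) := by
    intro c c'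
    refine sum_congr rfl fun x _ => sum_congr rfl fun x' _ => ?_
    rw [coeff39_factor]
    ring
  simp only [h]
  exact sum_sum_partition₂ ρ ρ' hρ hρ' _

/-- **The counterterm of (3.9) localized by two partitions of unity sums back to the unlocalized counterterm.**
[cite: Balaban1983Higgs3, (3.9) p.435] -/
theorem sum_counterTerm39_eq {C C' : Type*} [Fintype C] [Fintype C'] (ρ : C → SiteField P j ℝ) (ρ' : C' → SiteField P j ℝ)
    (hρ : IsPartition ρ) (hρ' : IsPartition ρ') (η : ℝ) (q : W →ₗ[ℝ] W) (Gj Gj' : Kernel P j) (φ φ' : SiteField P j W) :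
    ∑ c, ∑ c', counterTerm39 η q Gj Gj' (ρ c) (ρ' c') φ φ' = counterTerm39 η q Gj Gj' 1 1 φ φ' := by
  unfold counterTerm39
  have h : ∀ c c', ∑ x : Site P j, ∑ x' : Site P j,
      η ^ (2 * P.d) * (coeff39 η Gj Gj' (ρ c) (ρ' c') x x' * ⟪φ x, q (q (φ' x))⟫) =
      ∑ x : Site P j, ∑ x' : Site P j,
        ρ c x * ρ' c' x' * (η ^ (2 * P.d) * (coeff39 η Gj Gj' 1 1 x x' * ⟪φ x, q (q (φ' x))⟫)) := by
    intro c c'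
    refine sum_congr rfl fun x _ => sum_congr rfl fun x' _ => ?_
    rw [coeff39_factor]
    ring
  simp only [h]
  exact sum_sum_partition₂ ρ ρ' hρ hρ' _

/-- **THE IDENTIFICATION WHERE PRINT CONSUMES E(G, {□(v)}, …)**: (3.9) p. 435 *"where g, g′ are localization functions"* — for ANY two
partitions of unity `(g_c)_c`, `(g′_{c′})_{c′}` of the torus (print's smooth partitions, or unit cubes, or points) the localized
expressions (3.9) of the graph-with-counterterm (3.8) sum back to its expression with `g = g′ = 1`:
`Σ_{c,c′} expr39 η q G G′ g_c g′_{c′} φ φ′ = expr39 η q G G′ 1 1 φ φ′` — (3.9) is E((3.8), {□(x), □(x′)}, φ, φ′) in the sense of p. 420.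
[cite: Balaban1983Higgs3, (3.9) p.435] [cite: Balaban1983Higgs3, p.420] -/
theorem sum_expr39_eq {C C' : Type*} [Fintype C] [Fintype C'] (ρ : C → SiteField P j ℝ) (ρ' : C' → SiteField P j ℝ)
    (hρ : IsPartition ρ) (hρ' : IsPartition ρ') (η : ℝ) (q : W →ₗ[ℝ] W) (Gj Gj' : Kernel P j) (φ φ' : SiteField P j W) :
    ∑ c, ∑ c', expr39 η q Gj Gj' (ρ c) (ρ' c') φ φ' = expr39 η q Gj Gj' 1 1 φ φ' := by
  simp only [expr39, sum_add_distrib, sum_neg_distrib]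
  rw [sum_graphTerm39_eq ρ ρ' hρ hρ', sum_counterTerm39_eq ρ ρ' hρ hρ']

/-! ## §5 The class (3.8) = [(3.6)₁] − [(3.7)₁] as a localized class expression -/

/-- The summand of the drawn graph (3.6)₁ on its vertex set `{x, x′} = Fin 2` (legs `φ` at `x = xs 0`, `φ′` at `x′ = xs 1`, position
kernel `K`). [cite: Balaban1983Higgs3, (3.6) p.435] -/
def summand36 (η : ℝ) (K : (Fin 2 → Site P j) → W →ₗ[ℝ] W) (φ φ' : SiteField P j W) : (Fin 2 → Site P j) → ℝ :=
  fun xs => η ^ (2 * P.d) * ⟪φ (xs 0), K xs (φ' (xs 1))⟫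

/-- The summand of the counterterm picture (3.7)₁ on the SAME vertex set (both legs at `x = xs 0`, *"with the summation over x′"*,
p. 417). [cite: Balaban1983Higgs3, (3.7) p.435] -/
def summand37 (η : ℝ) (K : (Fin 2 → Site P j) → W →ₗ[ℝ] W) (φ φ' : SiteField P j W) : (Fin 2 → Site P j) → ℝ :=
  fun xs => η ^ (2 * P.d) * ⟪φ (xs 0), K xs (φ' (xs 0))⟫

/-- **The class (3.8)** = the signed family {(+1, (3.6)₁), (−1, (3.7)₁)} (p. 435: *"the renormalized class G_ren contains the
corresponding mass renormalization counterterms also: (−1)·[picture] …"*) as a class summand on the common vertex set `{x, x′}`.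
[cite: Balaban1983Higgs3, (3.8) p.435] -/
def class38 (η : ℝ) (K : (Fin 2 → Site P j) → W →ₗ[ℝ] W) (φ φ' : SiteField P j W) : (Fin 2 → Site P j) → ℝ :=
  classExpr univ ![(1 : ℝ), -1] ![summand36 η K φ φ', summand37 η K φ φ']

/-- The localized expression of the drawn picture (3.6)₁ is `locSum` of `summand36`. [cite: Balaban1983Higgs3, (3.6) p.435] -/
theorem ampW_pic36a_eq (η : ℝ) (w : Fin 2 → Site P j → ℝ) (K : (Fin 2 → Site P j) → W →ₗ[ℝ] W) (φ φ' : SiteField P j W) :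
    ampW (pic36a hn) (sLeg 0 1) (sLeg 1 1) η w K φ φ' = locSum w (summand36 η K φ φ') := by
  unfold ampW locSum summand36
  show ∑ xs : Fin 2 → Site P j, η ^ (2 * P.d) * locWeight w xs * ⟪φ (xs 0), K xs (φ' (xs 1))⟫ =
    ∑ xs : Fin 2 → Site P j, locWeight w xs * (η ^ (2 * P.d) * ⟪φ (xs 0), K xs (φ' (xs 1))⟫)
  exact sum_congr rfl fun xs _ => by ring

/-- The localized expression of the counterterm picture (3.7)₁ is `locSum` of `summand37`. [cite: Balaban1983Higgs3, (3.7) p.435] -/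
theorem ampW_pic37a_eq (η : ℝ) (w : Fin 2 → Site P j → ℝ) (K : (Fin 2 → Site P j) → W →ₗ[ℝ] W) (φ φ' : SiteField P j W) :
    ampW (pic37a hn) (sLeg 0 1) (sLeg 1 1) η w K φ φ' = locSum w (summand37 η K φ φ') := by
  unfold ampW locSum summand37
  rw [pic37a_loc, pic37a_loc, loc37_ext.1, loc37_ext.2]
  show ∑ xs : Fin 2 → Site P j, η ^ (2 * P.d) * locWeight w xs * ⟪φ (xs 0), K xs (φ' (xs 0))⟫ =
    ∑ xs : Fin 2 → Site P j, locWeight w xs * (η ^ (2 * P.d) * ⟪φ (xs 0), K xs (φ' (xs 0))⟫)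
  exact sum_congr rfl fun xs _ => by ring

/-- **E(G_ren, {□(x), □(x′)}, φ, φ′) for the class (3.8)** at any localization `w` of its two vertices: the localized graph term minus
the localized counterterm. [cite: Balaban1983Higgs3, (3.8) p.435] [cite: Balaban1983Higgs3, p.420] -/
theorem locSum_class38 (η : ℝ) (w : Fin 2 → Site P j → ℝ) (K : (Fin 2 → Site P j) → W →ₗ[ℝ] W) (φ φ' : SiteField P j W) :
    locSum w (class38 η K φ φ') =
      ampW (pic36a hn) (sLeg 0 1) (sLeg 1 1) η w K φ φ' - ampW (pic37a hn) (sLeg 0 1) (sLeg 1 1) η w K φ φ' := by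
  rw [class38, locSum_classExpr, Fin.sum_univ_two, ampW_pic36a_eq hn, ampW_pic37a_eq hn]
  simp only [Matrix.cons_val_zero, Matrix.cons_val_one]
  ring

/-- **(3.9) = −E((3.8), {g at x, g′ at x′}, φ, φ′)**: r15's `expr39` with the localization functions `g, g′` is minus the localized
class expression of (3.8) with the unweighted kernel `Σ₃₉(1, 1)` (the exterior sign of (3.9)). [cite: Balaban1983Higgs3, (3.9) p.435] -/
theorem expr39_eq_neg_locSum_class38 (η : ℝ) (q : W →ₗ[ℝ] W) (Gj Gj' : Kernel P j) (g g' : SiteField P j ℝ)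
    (φ φ' : SiteField P j W) :
    expr39 η q Gj Gj' g g' φ φ' =
      -locSum (w39 g g') (class38 η (kernel2 (sigma39 η q Gj Gj' 1 1)) φ φ') := by
  rw [locSum_class38 (nbar := 1) le_rfl, expr39_eq_ampW (nbar := 1) le_rfl]

/-- **The localization theorem for the class (3.8)**: localizing its two vertices by ANY partitions of unity and summing over all
assignments gives the unlocalized class expression [(3.6)₁] − [(3.7)₁] (this lineage's `LocPicture.amp`). [cite: Balaban1983Higgs3, p.420] -/
theorem sum_locSum_class38_eq (η : ℝ) {C : Fin 2 → Type*} [∀ v, Fintype (C v)] (ρ : (v : Fin 2) → C v → Site P j → ℝ)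
    (hρ : ∀ v, IsPartition (ρ v)) (K : (Fin 2 → Site P j) → W →ₗ[ℝ] W) (φ φ' : SiteField P j W) :
    ∑ c : (v : Fin 2) → C v, locSum (fun v => ρ v (c v)) (class38 η K φ φ') =
      (pic36a hn).amp (sLeg 0 1) (sLeg 1 1) η K φ φ' - (pic37a hn).amp (sLeg 0 1) (sLeg 1 1) η K φ φ' := by
  have h36 := sum_ampW_eq_amp (pic36a hn) (sLeg 0 1) (sLeg 1 1) η ρ hρ K φ φ'
  have h37 := sum_ampW_eq_amp (pic37a hn) (sLeg 0 1) (sLeg 1 1) η ρ hρ K φ φ'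
  simp only [locSum_class38 hn, sum_sub_distrib]
  exact congrArg₂ (· - ·) h36 h37

end

end Pictures

end Literature.MathematicalPhysics.QuantumFieldTheory.Balaban1983to89.B3LocalizedExpression420
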